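import Mathlib.Analysis.Calculus.ContDiff.Bounds
import Mathlib.Analysis.Calculus.FDeriv.Analytic
import Mathlib.Analysis.Calculus.ContDiff.CPolynomial
import Mathlib.Algebra.Order.CauSeq.BigOperators
import HarnessLib

/-!
# The `T_φ(𝔥)`-seminorm of Bauerschmidt–Brydges–Slade and its product property

The seminorm by which the Brydges–Slade renormalisation group measures a smooth function `F` of a
field `φ ∈ E` (a real normed space) with values in a normed algebra `A` (`ℝ`, or `ℂ` for complex
activities): with the field measured in units of `𝔥 > 0` and Taylor order truncated at `p_N`,

  `‖F‖_{T_φ(𝔥)} = ∑_{p ≤ p_N} (𝔥^p / p!) ‖D^p F(φ)‖`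

(Bauerschmidt–Brydges–Slade 2019, Def. 7.1.1 with `p_𝒵 = (p_N, 0, 0)`: the `p`-th Fréchet
derivative is normed as a `p`-linear map on `ℝ^n_𝔥 = (ℝⁿ, 𝔥⁻¹|·|)`, i.e. `𝔥^p ‖D^pF(φ)‖`), here
`tphiSeminorm pN 𝔥 F φ` with Mathlib's `iteratedFDeriv ℝ p F φ` and its operator norm. We prove

* the elementary properties (nonnegativity, `‖F(φ)‖ ≤ ‖F‖_{T_φ}`, order `0` is the absolute value,
  monotonicity in `𝔥` and in `p_N`, triangle inequality, homogeneity, constants);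
* **the product property** `‖FG‖_{T_φ} ≤ ‖F‖_{T_φ} ‖G‖_{T_φ}` (BBS 2019, Lemma 7.1.2: "just as the
  Taylor expansion of the product of two functions is the product of the Taylor expansions"), from
  the Leibniz bound `‖Dⁿ(FG)‖ ≤ ∑ C(n,i) ‖DⁱF‖ ‖Dⁿ⁻ⁱG‖` (Mathlib `norm_iteratedFDeriv_mul_le`) and the
  rearrangement `∑_{n ≤ N} ∑_{i ≤ n} = ∑_{i ≤ N} ∑_{j ≤ N-i}`;
* powers `‖Fᵏ‖_{T_φ} ≤ ‖F‖_{T_φ}ᵏ`;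
* **the norm of a homogeneous polynomial** (BBS 2019, (7.1.5) / Exercise 7.1.3): for a continuous
  `k`-linear `M` and `F(φ) = M(φ,…,φ)`, `‖F‖_{T_φ(𝔥)} ≤ ‖M‖ (‖φ‖ + 𝔥)^k`.

The truncation `p_N < ∞` keeps every statement a finite sum (BBS: "we include finite choices to
emphasise that there is no need for analyticity"); the product property holds at every order.
Context: norms for the single-regime RG of crux `BalabanIR.BirComplexStableXYR` (Hubbard summit),
line `fat-gaussian-defect-calculus`, definition layer D1′(c).

## References

* R. Bauerschmidt, D. C. Brydges, G. Slade, *Introduction to a Renormalisation Group Method*,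
  Lecture Notes in Math. 2242, Springer 2019 (arXiv:1907.05474), Ch. 7: Def. 7.1.1, Lemma 7.1.2,
  (7.1.5), Exercise 7.1.3. [BauerschmidtBrydgesSlade2019RG]
* D. C. Brydges, G. Slade, *A renormalisation group method. I. Gaussian integration and normed
  algebras*, J. Stat. Phys. 159 (2015) 421–460 (the general `T_φ` norms). [BrydgesSlade2015I]
-/

noncomputable section

namespace Literature.MathematicalPhysics.QuantumFieldTheory

open Finset
open scoped Nat

variable {E : Type*} [NormedAddCommGroup E] [NormedSpace ℝ E]
variable {A : Type*} [NormedRing A] [NormedAlgebra ℝ A]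

/-- **The `T_φ(𝔥)`-seminorm** of a function `F : E → A` at the field `φ`, truncated at Taylor
order `pN`: `∑_{p ≤ pN} (𝔥^p/p!) ‖D^p F(φ)‖`. [cite: BauerschmidtBrydgesSlade2019RG, Def. 7.1.1] -/
def tphiSeminorm (pN : ℕ) (𝔥 : ℝ) (F : E → A) (φ : E) : ℝ :=
  ∑ p ∈ range (pN + 1), 𝔥 ^ p / (p ! : ℝ) * ‖iteratedFDeriv ℝ p F φ‖

/-! ### Elementary properties -/

/-- Unfolding the definition. [folklore] -/
theorem tphiSeminorm_def (pN : ℕ) (𝔥 : ℝ) (F : E → A) (φ : E) :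
    tphiSeminorm pN 𝔥 F φ = ∑ p ∈ range (pN + 1), 𝔥 ^ p / (p ! : ℝ) * ‖iteratedFDeriv ℝ p F φ‖ := rfl

/-- The seminorm is nonnegative (for `𝔥 ≥ 0`). [folklore] -/
theorem tphiSeminorm_nonneg (pN : ℕ) {𝔥 : ℝ} (h𝔥 : 0 ≤ 𝔥) (F : E → A) (φ : E) : 0 ≤ tphiSeminorm pN 𝔥 F φ :=
  sum_nonneg fun p _ => by positivity

/-- At Taylor order `0` the seminorm is the absolute value `‖F(φ)‖`. [cite: BauerschmidtBrydgesSlade2019RG, §7.1] -/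
theorem tphiSeminorm_zero_order (𝔥 : ℝ) (F : E → A) (φ : E) : tphiSeminorm 0 𝔥 F φ = ‖F φ‖ := by
  simp [tphiSeminorm, norm_iteratedFDeriv_zero]

/-- Splitting off the order-`0` term: `‖F‖_{T_φ} = ‖F(φ)‖ + ∑_{1 ≤ p ≤ pN} (𝔥^p/p!)‖D^pF(φ)‖`. [folklore] -/
theorem tphiSeminorm_eq_norm_add (pN : ℕ) (𝔥 : ℝ) (F : E → A) (φ : E) :
    tphiSeminorm pN 𝔥 F φ = ‖F φ‖ + ∑ p ∈ range pN, 𝔥 ^ (p + 1) / ((p + 1)! : ℝ) * ‖iteratedFDeriv ℝ (p + 1) F φ‖ := by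
  rw [tphiSeminorm, sum_range_succ']
  simp [norm_iteratedFDeriv_zero, add_comm]

/-- **The seminorm dominates the absolute value**: `‖F(φ)‖ ≤ ‖F‖_{T_φ(𝔥)}`. [cite: BauerschmidtBrydgesSlade2019RG, §7.1] -/
theorem norm_le_tphiSeminorm (pN : ℕ) {𝔥 : ℝ} (h𝔥 : 0 ≤ 𝔥) (F : E → A) (φ : E) :
    ‖F φ‖ ≤ tphiSeminorm pN 𝔥 F φ := by
  rw [tphiSeminorm_eq_norm_add]
  have : 0 ≤ ∑ p ∈ range pN, 𝔥 ^ (p + 1) / ((p + 1)! : ℝ) * ‖iteratedFDeriv ℝ (p + 1) F φ‖ :=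
    sum_nonneg fun p _ => by positivity
  linarith

/-- Monotonicity in the Taylor order. [folklore] -/
theorem tphiSeminorm_mono_order {pN pN' : ℕ} (hp : pN ≤ pN') {𝔥 : ℝ} (h𝔥 : 0 ≤ 𝔥) (F : E → A) (φ : E) :
    tphiSeminorm pN 𝔥 F φ ≤ tphiSeminorm pN' 𝔥 F φ :=
  sum_le_sum_of_subset_of_nonneg (range_mono (by omega)) fun p _ _ => by positivity

/-- **Monotonicity in `𝔥`** ("monotone increasing in `𝔥`"). [cite: BauerschmidtBrydgesSlade2019RG, §7.1] -/
theorem tphiSeminorm_mono_h (pN : ℕ) {𝔥 𝔥' : ℝ} (h𝔥 : 0 ≤ 𝔥) (hle : 𝔥 ≤ 𝔥') (F : E → A) (φ : E) :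
    tphiSeminorm pN 𝔥 F φ ≤ tphiSeminorm pN 𝔥' F φ :=
  sum_le_sum fun p _ => by
    have : 𝔥 ^ p ≤ 𝔥' ^ p := pow_le_pow_left₀ h𝔥 hle p
    have h2 : 0 ≤ ‖iteratedFDeriv ℝ p F φ‖ := norm_nonneg _
    have h3 : (0 : ℝ) < p ! := by positivity
    exact mul_le_mul_of_nonneg_right (div_le_div_of_nonneg_right this h3.le) h2

/-- The seminorm of a constant is its norm. [folklore] -/
theorem tphiSeminorm_const (pN : ℕ) (𝔥 : ℝ) (a : A) (φ : E) :
    tphiSeminorm pN 𝔥 (fun _ : E => a) φ = ‖a‖ := by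
  rw [tphiSeminorm_eq_norm_add]
  simp [iteratedFDeriv_const_of_ne]

/-- The seminorm of the zero function vanishes. [folklore] -/
theorem tphiSeminorm_zero (pN : ℕ) (𝔥 : ℝ) (φ : E) : tphiSeminorm pN 𝔥 (fun _ : E => (0 : A)) φ = 0 := by
  rw [tphiSeminorm_const, norm_zero]

/-- **Triangle inequality.** [cite: BauerschmidtBrydgesSlade2019RG, §7.1] -/
theorem tphiSeminorm_add_le (pN : ℕ) {𝔥 : ℝ} (h𝔥 : 0 ≤ 𝔥) {F G : E → A} (hF : ContDiff ℝ pN F)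
    (hG : ContDiff ℝ pN G) (φ : E) :
    tphiSeminorm pN 𝔥 (fun x => F x + G x) φ ≤ tphiSeminorm pN 𝔥 F φ + tphiSeminorm pN 𝔥 G φ := by
  unfold tphiSeminorm
  rw [← sum_add_distrib]
  refine sum_le_sum fun p hp => ?_
  have hp' : (p : WithTop ℕ∞) ≤ (pN : WithTop ℕ∞) := by exact_mod_cast Nat.lt_succ_iff.1 (mem_range.1 hp)
  rw [← mul_add]
  refine mul_le_mul_of_nonneg_left ?_ (by positivity)
  rw [show (fun x => F x + G x) = F + G from rfl,
    iteratedFDeriv_add_apply (hF.of_le hp').contDiffAt (hG.of_le hp').contDiffAt]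
  exact norm_add_le _ _

/-- **Homogeneity**: `‖c F‖_{T_φ} = |c| ‖F‖_{T_φ}`. [folklore] -/
theorem tphiSeminorm_smul (pN : ℕ) (𝔥 : ℝ) (c : ℝ) {F : E → A} (hF : ContDiff ℝ pN F) (φ : E) :
    tphiSeminorm pN 𝔥 (fun x => c • F x) φ = |c| * tphiSeminorm pN 𝔥 F φ := by
  unfold tphiSeminorm
  rw [mul_sum]
  refine sum_congr rfl fun p hp => ?_
  have hp' : (p : WithTop ℕ∞) ≤ (pN : WithTop ℕ∞) := by exact_mod_cast Nat.lt_succ_iff.1 (mem_range.1 hp)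
  rw [iteratedFDeriv_const_smul_apply' (hF.of_le hp').contDiffAt, norm_smul, Real.norm_eq_abs]
  ring

/-- Negation does not change the seminorm. [folklore] -/
theorem tphiSeminorm_neg (pN : ℕ) (𝔥 : ℝ) {F : E → A} (hF : ContDiff ℝ pN F) (φ : E) :
    tphiSeminorm pN 𝔥 (fun x => -F x) φ = tphiSeminorm pN 𝔥 F φ := by
  have h := tphiSeminorm_smul pN 𝔥 (-1) hF φ
  simp only [neg_smul, one_smul, abs_neg, abs_one, one_mul] at h
  exact h

/-! ### The product property -/

/-- The rearrangement behind the product property: for nonnegative `a, b` and `𝔥 ≥ 0`,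
`∑_{n ≤ N} (𝔥ⁿ/n!) ∑_{i ≤ n} C(n,i) aᵢ b_{n-i} ≤ (∑_{i ≤ N} 𝔥ⁱaᵢ/i!)(∑_{j ≤ N} 𝔥ʲbⱼ/j!)`. [cite: BauerschmidtBrydgesSlade2019RG, Lemma 7.1.2] -/
theorem sum_choose_weighted_le_mul (N : ℕ) {𝔥 : ℝ} (h𝔥 : 0 ≤ 𝔥) {a b : ℕ → ℝ} (ha : ∀ i, 0 ≤ a i)
    (hb : ∀ j, 0 ≤ b j) :
    ∑ n ∈ range (N + 1), 𝔥 ^ n / (n ! : ℝ) * ∑ i ∈ range (n + 1), (n.choose i : ℝ) * a i * b (n - i) ≤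
      (∑ i ∈ range (N + 1), 𝔥 ^ i / (i ! : ℝ) * a i) * (∑ j ∈ range (N + 1), 𝔥 ^ j / (j ! : ℝ) * b j) := by
  have hcn : ∀ i j, 0 ≤ (𝔥 ^ i / (i ! : ℝ) * a i) * (𝔥 ^ j / (j ! : ℝ) * b j) := fun i j =>
    mul_nonneg (mul_nonneg (div_nonneg (pow_nonneg h𝔥 _) (by positivity)) (ha i))
      (mul_nonneg (div_nonneg (pow_nonneg h𝔥 _) (by positivity)) (hb j))
  -- rewrite each term through `c i (n - i)` with `c i j = (𝔥ⁱaᵢ/i!)(𝔥ʲbⱼ/j!)`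
  have hterm : ∀ n ∈ range (N + 1), 𝔥 ^ n / (n ! : ℝ) * ∑ i ∈ range (n + 1), (n.choose i : ℝ) * a i * b (n - i) =
      ∑ i ∈ range (n + 1), (𝔥 ^ i / (i ! : ℝ) * a i) * (𝔥 ^ (n - i) / ((n - i)! : ℝ) * b (n - i)) := by
    intro n _
    rw [mul_sum]
    refine sum_congr rfl fun i hi => ?_
    have hin : i ≤ n := Nat.lt_succ_iff.1 (mem_range.1 hi)
    have hch : (n.choose i : ℝ) * (i ! : ℝ) * ((n - i)! : ℝ) = (n ! : ℝ) := by
      exact_mod_cast Nat.choose_mul_factorial_mul_factorial hin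
    have hi0 : (i ! : ℝ) ≠ 0 := by positivity
    have hni0 : ((n - i)! : ℝ) ≠ 0 := by positivity
    have hn0 : (n ! : ℝ) ≠ 0 := by positivity
    rw [show 𝔥 ^ n = 𝔥 ^ i * 𝔥 ^ (n - i) by rw [← pow_add, Nat.add_sub_cancel' hin]]
    field_simp
    rw [← hch]
    ring
  have hflip := Finset.sum_range_diag_flip (N + 1)
    (fun i j => (𝔥 ^ i / (i ! : ℝ) * a i) * (𝔥 ^ j / (j ! : ℝ) * b j))
  beta_reduce at hflip
  rw [sum_congr rfl hterm, hflip, sum_mul_sum]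
  refine sum_le_sum fun i _ => ?_
  exact sum_le_sum_of_subset_of_nonneg (range_mono (by omega)) fun j _ _ => hcn i j

/-- **The product property of the `T_φ`-seminorm**: `‖FG‖_{T_φ(𝔥)} ≤ ‖F‖_{T_φ(𝔥)} ‖G‖_{T_φ(𝔥)}`
for `C^{p_N}` functions with values in a normed algebra. [cite: BauerschmidtBrydgesSlade2019RG, Lemma 7.1.2] -/
theorem tphiSeminorm_mul_le (pN : ℕ) {𝔥 : ℝ} (h𝔥 : 0 ≤ 𝔥) {F G : E → A} (hF : ContDiff ℝ pN F)
    (hG : ContDiff ℝ pN G) (φ : E) :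
    tphiSeminorm pN 𝔥 (fun x => F x * G x) φ ≤ tphiSeminorm pN 𝔥 F φ * tphiSeminorm pN 𝔥 G φ := by
  unfold tphiSeminorm
  calc ∑ p ∈ range (pN + 1), 𝔥 ^ p / (p ! : ℝ) * ‖iteratedFDeriv ℝ p (fun x => F x * G x) φ‖
      ≤ ∑ n ∈ range (pN + 1), 𝔥 ^ n / (n ! : ℝ) * ∑ i ∈ range (n + 1),
          (n.choose i : ℝ) * ‖iteratedFDeriv ℝ i F φ‖ * ‖iteratedFDeriv ℝ (n - i) G φ‖ := by
        refine sum_le_sum fun n hn => mul_le_mul_of_nonneg_left ?_ (by positivity)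
        have hn' : (n : WithTop ℕ∞) ≤ (pN : WithTop ℕ∞) := by exact_mod_cast Nat.lt_succ_iff.1 (mem_range.1 hn)
        exact norm_iteratedFDeriv_mul_le hF hG φ hn'
    _ ≤ _ := by
        have h := sum_choose_weighted_le_mul pN h𝔥 (a := fun i => ‖iteratedFDeriv ℝ i F φ‖)
          (b := fun j => ‖iteratedFDeriv ℝ j G φ‖) (fun i => norm_nonneg _) (fun j => norm_nonneg _)
        beta_reduce at h
        exact h

/-- **Powers**: `‖Fᵏ‖_{T_φ} ≤ ‖F‖_{T_φ}ᵏ` for `k ≥ 1`. [cite: BauerschmidtBrydgesSlade2019RG, Lemma 7.1.2] -/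
theorem tphiSeminorm_pow_le (pN : ℕ) {𝔥 : ℝ} (h𝔥 : 0 ≤ 𝔥) {F : E → A} (hF : ContDiff ℝ pN F) (φ : E) :
    ∀ k : ℕ, 1 ≤ k → tphiSeminorm pN 𝔥 (fun x => F x ^ k) φ ≤ tphiSeminorm pN 𝔥 F φ ^ k
  | 0, h => absurd h (by omega)
  | 1, _ => by simp
  | k + 2, _ => by
    have ih := tphiSeminorm_pow_le pN h𝔥 hF φ (k + 1) (by omega)
    have hpow : ContDiff ℝ pN (fun x => F x ^ (k + 1)) := hF.pow (k + 1)
    calc tphiSeminorm pN 𝔥 (fun x => F x ^ (k + 2)) φ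
        = tphiSeminorm pN 𝔥 (fun x => F x ^ (k + 1) * F x) φ := by simp_rw [pow_succ _ (k + 1)]
      _ ≤ tphiSeminorm pN 𝔥 (fun x => F x ^ (k + 1)) φ * tphiSeminorm pN 𝔥 F φ :=
          tphiSeminorm_mul_le pN h𝔥 hpow hF φ
      _ ≤ tphiSeminorm pN 𝔥 F φ ^ (k + 1) * tphiSeminorm pN 𝔥 F φ :=
          mul_le_mul_of_nonneg_right ih (tphiSeminorm_nonneg pN h𝔥 F φ)
      _ = tphiSeminorm pN 𝔥 F φ ^ (k + 2) := by rw [← pow_succ]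

/-! ### Homogeneous polynomials -/

/-- The diagonal embedding `φ ↦ (φ,…,φ)` has operator norm at most one. [folklore] -/
theorem norm_pi_id_le (k : ℕ) : ‖ContinuousLinearMap.pi fun _ : Fin k => ContinuousLinearMap.id ℝ E‖ ≤ 1 :=
  ContinuousLinearMap.norm_pi_le_of_le (fun _ => ContinuousLinearMap.norm_id_le) zero_le_one

/-- **Derivatives of a homogeneous polynomial**: for a continuous `k`-linear `M` and
`F(φ) = M(φ,…,φ)`, `‖D^pF(φ)‖ ≤ k^{(p)} ‖M‖ ‖φ‖^{k-p}` (falling factorial; zero for `p > k`).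
[cite: BauerschmidtBrydgesSlade2019RG, (7.1.5)] -/
theorem norm_iteratedFDeriv_diag_le {k : ℕ} (M : ContinuousMultilinearMap ℝ (fun _ : Fin k => E) A)
    (p : ℕ) (φ : E) :
    ‖iteratedFDeriv ℝ p (fun x : E => M fun _ => x) φ‖ ≤ (k.descFactorial p : ℝ) * ‖M‖ * ‖φ‖ ^ (k - p) := by
  set L : E →L[ℝ] (Fin k → E) := ContinuousLinearMap.pi fun _ : Fin k => ContinuousLinearMap.id ℝ E with hL
  have hcomp : (fun x : E => M fun _ => x) = (M : (Fin k → E) → A) ∘ L := by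
    funext x; simp [hL]
  rw [hcomp, ContinuousLinearMap.iteratedFDeriv_comp_right L (ContinuousMultilinearMap.contDiff M) φ (i := p)
    (mod_cast le_top)]
  refine (ContinuousMultilinearMap.norm_compContinuousLinearMap_le _ _).trans ?_
  have hLn : ‖L‖ ≤ 1 := norm_pi_id_le k
  have h1 : ∏ _i : Fin p, ‖L‖ ≤ 1 := prod_le_one (fun _ _ => norm_nonneg _) fun _ _ => hLn
  have h2 := ContinuousMultilinearMap.norm_iteratedFDeriv_le M p (L φ)
  simp only [Fintype.card_fin] at h2
  have hLφ : ‖L φ‖ ≤ ‖φ‖ := (L.le_opNorm φ).trans (by nlinarith [norm_nonneg φ])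
  calc ‖iteratedFDeriv ℝ p (⇑M) (L φ)‖ * ∏ _i : Fin p, ‖L‖
      ≤ ‖iteratedFDeriv ℝ p (⇑M) (L φ)‖ * 1 := mul_le_mul_of_nonneg_left h1 (norm_nonneg _)
    _ ≤ (k.descFactorial p : ℝ) * ‖M‖ * ‖L φ‖ ^ (k - p) := by rw [mul_one]; exact h2
    _ ≤ (k.descFactorial p : ℝ) * ‖M‖ * ‖φ‖ ^ (k - p) := by
        gcongr

/-- **The `T_φ`-seminorm of a homogeneous polynomial**: `‖M(φ,…,φ)‖_{T_φ(𝔥)} ≤ ‖M‖ (‖φ‖ + 𝔥)^k`.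
[cite: BauerschmidtBrydgesSlade2019RG, Exercise 7.1.3] -/
theorem tphiSeminorm_diag_le (pN : ℕ) {𝔥 : ℝ} (h𝔥 : 0 ≤ 𝔥) {k : ℕ}
    (M : ContinuousMultilinearMap ℝ (fun _ : Fin k => E) A) (φ : E) :
    tphiSeminorm pN 𝔥 (fun x : E => M fun _ => x) φ ≤ ‖M‖ * (‖φ‖ + 𝔥) ^ k := by
  -- termwise bound by `‖M‖ C(k,p) 𝔥^p ‖φ‖^{k-p}` (zero for `p > k`)
  set f : ℕ → ℝ := fun p => ‖M‖ * ((k.choose p : ℝ) * 𝔥 ^ p * ‖φ‖ ^ (k - p)) with hf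
  have hfn : ∀ p, 0 ≤ f p := fun p => by simp only [hf]; positivity
  have hf0 : ∀ p, k < p → f p = 0 := fun p hp => by
    simp only [hf, Nat.choose_eq_zero_of_lt hp, Nat.cast_zero, zero_mul, mul_zero]
  have hterm : ∀ p ∈ range (pN + 1), 𝔥 ^ p / (p ! : ℝ) * ‖iteratedFDeriv ℝ p (fun x : E => M fun _ => x) φ‖ ≤ f p := by
    intro p _
    have h1 := norm_iteratedFDeriv_diag_le M p φ
    have hp0 : (0 : ℝ) < p ! := by positivity
    calc 𝔥 ^ p / (p ! : ℝ) * ‖iteratedFDeriv ℝ p (fun x : E => M fun _ => x) φ‖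
        ≤ 𝔥 ^ p / (p ! : ℝ) * ((k.descFactorial p : ℝ) * ‖M‖ * ‖φ‖ ^ (k - p)) :=
          mul_le_mul_of_nonneg_left h1 (by positivity)
      _ = f p := by
          simp only [hf]
          rw [Nat.descFactorial_eq_factorial_mul_choose]
          push_cast
          field_simp
  calc tphiSeminorm pN 𝔥 (fun x : E => M fun _ => x) φ
      ≤ ∑ p ∈ range (pN + 1), f p := sum_le_sum hterm
    _ ≤ ∑ p ∈ range (pN + k + 1), f p :=
        sum_le_sum_of_subset_of_nonneg (range_mono (by omega)) fun p _ _ => hfn p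
    _ = ∑ p ∈ range (k + 1), f p := by
        refine (sum_subset (range_mono (by omega)) fun p hp hpk => hf0 p ?_).symm
        simp only [mem_range, not_lt] at hp hpk
        omega
    _ = ‖M‖ * (‖φ‖ + 𝔥) ^ k := by
        simp only [hf, ← mul_sum]
        congr 1
        rw [show ‖φ‖ + 𝔥 = 𝔥 + ‖φ‖ from add_comm _ _, add_pow]
        refine sum_congr rfl fun p _ => ?_
        ring

end Literature.MathematicalPhysics.QuantumFieldTheory

end
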